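import Literature.AnabelianGeometry.SemiGraphs.PSCCuspidalCriterionOriginReduction
import Literature.AnabelianGeometry.SemiGraphs.PSCSmoothCurveShape
import HarnessLib

/-!
# [CombGC] Theorem 1.6 (i) at pro-`l` smooth-curve origins: reduced to [IUTchI] Rmk. 1.2.3 (iv) alone, at genuine data

Mochizuki, *A combinatorial version of the Grothendieck conjecture*, Tohoku Math. J. **59** (2007)
[CombGC], §1, Theorem 1.6 (i) p. 13 (proof pp. 13–14, "Sufficiency is immediate [cf. Proposition 1.2,
(i)] … by projecting to the maximal pro-`l` quotients … we may assume … that `Σ = {l}` … the cuspidal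
edge-like subgroups may be characterized …"), as amended by [IUTchI] Rmk. 1.2.3 (iii)(iv)(vi) (kurims
manuscript pp. 41–43).  PROOF-ONLY sequel of `PSCCuspidalCriterionOriginReduction.lean` (abc-iut-f-164,
FACT tranche 164, row F-0458 `PSCDatum.NumericallyCuspidalIffHolds`) composed with abc-iut-L3-t4's
`PSCSmoothCurveShape.lean` (data of SMOOTH-CURVE shape: one vertex with `Π_v = Π`, no nodes, cusp
groups the closed cusp inertia groups of a pro-`Σ` completion `ι : Γ_{g,r} → Π` of a hyperbolic
punctured surface group; there Prop. 1.2 (i) as printed — row F-0459 — is PROVED from the tree's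
malnormality theorem for cusp inertia, `openInterDeterminesComponentHolds_of_smoothCurve`).

* `numericallyCuspidalIffHolds_of_smoothCurve_of_characterization`: at every origin all of whose data
  are of smooth-curve shape with `Σ = {l}`, Theorem 1.6 (i) as printed (F-0458) follows from the
  SINGLE named fact [IUTchI] Rmk. 1.2.3 (iv) (`CuspidalEdgeLikeCharacterizationHolds Ω`, F-1931) —
  exactly the printed dependency "necessity follows formally from the characterization of cuspidal
  subgroups" once Prop. 1.2 (i) is a theorem there;
* `isProSigma_of_isProSigmaCompletion`: a pro-`Σ` completion in the sense of abc-iut-L3-t1's interface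
  (`SemiGraphOfAnabelioids.IsProSigmaCompletion`) is a pro-`Σ` group in the sense of the PSC interface
  (`IsProSigma`) — the index clause read on open normal subgroups;
* `exists_proL_smoothCurveOrigin_holds`: for every prime `l` such an origin is INHABITED by GENUINE
  data — the pro-`l` tripod: `Π` = the maximal pro-`l` quotient of `Γ_{0,3} = π₁(P¹ ∖ {0,1,∞})`
  (`IsProSigmaCompletion.exists_isProSigmaCompletion`, abc-iut-L3 models file), three cusps with
  `Π_{c_i} = closure ι⟨c_i⟩`, `Σ = {l}` — and at it F-0438 ∧ F-0459 ∧ F-0440 ∧ F-0461 ∧ F-0443 HOLD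
  (abc-iut-L3-t4's smooth-curve instance forms, BY NAME) and F-0458 ⇐ F-1931.

Honest scope: the remaining input F-1931 (the ramification-theoretic characterization of cuspidal
subgroups) is the deep, origin-dependent content of Theorem 1.6 (i) and is NOT proved here; the typed
rows stay assumption labels (FACT policy).  Nothing is asserted about all pointed stable curves; nothing
here takes a side on [IUTchIII] Cor. 3.12. [cite: MochizukiCombGC2007, Thm 1.6(i) p.13]
-/

noncomputable section

namespace Literature.AnabelianGeometry.SemiGraphs

namespace PSCDatum

open scoped Pointwise
open Literature.GroupTheory.CombinatorialGroupTheory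
open SemiGraphOfAnabelioids (IsProSigmaCompletion)

universe u

/-! ### Pro-`Σ` completions are pro-`Σ` groups -/

/-- The target of a pro-`Σ` completion `ι : Γ → Π` ([SemiAnbd] Ex. 2.10 interface: open normal
subgroups have `Σ`-integer index) is a pro-`Σ` group in the sense of the PSC interface ([CombGC] Def.
1.1 (ii): every prime dividing the order of a finite continuous quotient lies in `Σ`).
[cite: MochizukiCombGC2007, Def 1.1(ii) p.6] -/
theorem isProSigma_of_isProSigmaCompletion {Sigma : Set ℕ} {Γ : Type*} [Group Γ] {Q : Type u} [Group Q]
    [TopologicalSpace Q] {ι : Γ →* Q} (hι : IsProSigmaCompletion Sigma ι) : IsProSigma Sigma Q :=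
  ⟨fun U _ p hp hdvd => by
    have h := hι.index_open (U : Subgroup Q) inferInstance U.isOpen
    rw [← Subgroup.index_eq_card] at hdvd
    exact h.2 p hp hdvd⟩

/-! ### F-0458 at pro-`l` smooth-curve origins -/

section Origin

variable (Ω : PSCOrigin.{u}) (l : ℕ)

/-- **[CombGC] Theorem 1.6 (i) as printed (F-0458) at every pro-`l` smooth-curve origin, REDUCED to
[IUTchI] Rmk. 1.2.3 (iv) (F-1931) alone.**  If every datum of `Ω`-PSC-type is of smooth-curve shape
(profinite `Π`, one vertex, no nodes, cusp groups = closed cusp inertia of a pro-`Σ'` completion of a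
hyperbolic `Γ_{g,r}`) and has `Σ = {l}`, then the characterization of cuspidal subgroups
(`CuspidalEdgeLikeCharacterizationHolds Ω`) implies "`α` is numerically cuspidal iff it is
group-theoretically cuspidal" for all `G`, `H` of `Ω`-type and every `α : Π_G ≅ Π_H`: Prop. 1.2 (i) is a
THEOREM at such origins (abc-iut-L3-t4's `openInterDeterminesComponentHolds_of_smoothCurve`, from the
tree's cusp-inertia malnormality), and the rest is `numericallyCuspidalIffHolds_of_characterization`.
[cite: MochizukiCombGC2007, Thm 1.6(i) p.13] -/
theorem numericallyCuspidalIffHolds_of_smoothCurve_of_characterization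
    (hΩ : ∀ ⦃Q : Type u⦄ [Group Q] [TopologicalSpace Q] [IsTopologicalGroup Q] (G : PSCDatum Q),
      Ω.IsOfPSCType G → CompactSpace Q ∧ T2Space Q ∧ TotallyDisconnectedSpace Q ∧ IsEmpty G.graph.N ∧
        (∃ v₀ : G.graph.V, ∀ w, w = v₀) ∧
        ∃ (S : Set ℕ) (g r : ℕ) (ι : PuncturedSurfaceGroup g r →* Q) (e : G.graph.C ≃ Fin r),
          S.Nonempty ∧ (∀ p ∈ S, p.Prime) ∧ PuncturedSurfaceGroup.IsHyperbolicType g r ∧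
          IsProSigmaCompletion S ι ∧
          ∀ c, G.cuspGp c = ((PuncturedSurfaceGroup.cuspInertia (g := g) (e c)).map ι).topologicalClosure)
    (hSig : ∀ ⦃Q : Type u⦄ [Group Q] [TopologicalSpace Q] [IsTopologicalGroup Q] (G : PSCDatum Q),
      Ω.IsOfPSCType G → G.Sigma = {l})
    (hchar : CuspidalEdgeLikeCharacterizationHolds Ω) : NumericallyCuspidalIffHolds Ω :=
  numericallyCuspidalIffHolds_of_characterization Ω l
    (fun _ _ _ _ G hG => ⟨(hΩ G hG).1, (hΩ G hG).2.2.1⟩) hSig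
    (openInterDeterminesComponentHolds_of_smoothCurve Ω hΩ) hchar

end Origin

/-! ### Inhabitation: the pro-`l` tripod -/

/-- **The pro-`l` smooth-curve origin is inhabited by genuine data; there F-0438 ∧ F-0459 ∧ F-0440 ∧
F-0461 ∧ F-0443 hold and F-0458 ⇐ F-1931.**  For a prime `l`, let `Ω` declare "of PSC-type" exactly
the data of smooth-curve shape with `Σ = {l}`.  Then `Ω` contains the datum of the pro-`l` TRIPOD —
`Π` = a pro-`{l}` completion of `Γ_{0,3} = π₁(P¹ ∖ {0,1,∞})` (abc-iut-L3's
`IsProSigmaCompletion.exists_isProSigmaCompletion`), one vertex with `Π_v = Π` of genus `0`, no nodes,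
three cusps with `Π_{c_i} = closure ι⟨c_i⟩` — and at `Ω`: Prop. 1.2 (ii), Prop. 1.2 (i), Prop. 1.5 (i),
Thm. 1.6 (iii), Prop. 1.5 (ii) hold (abc-iut-L3-t4's smooth-curve instance forms BY NAME), and Thm. 1.6
(i) as printed follows from [IUTchI] Rmk. 1.2.3 (iv) as printed.  Consistency / reduction evidence for
the typed schemata at genuine anabelian data; not the printed theorem for all pointed stable curves.
[cite: MochizukiCombGC2007, Thm 1.6(i) p.13] -/
theorem exists_proL_smoothCurveOrigin_holds (l : ℕ) (hl : l.Prime) :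
    ∃ Ω : PSCOrigin.{0},
      (∃ (Q : ProfiniteGrp.{0}) (ι : PuncturedSurfaceGroup 0 3 →* Q) (G : PSCDatum Q),
        IsProSigmaCompletion {l} ι ∧ Ω.IsOfPSCType G ∧ G.Sigma = {l} ∧ G.graph.i = 1 ∧ G.graph.n = 0 ∧
          G.graph.r = 3 ∧ (∀ v, G.vertGp v = ⊤ ∧ G.genus v = 0) ∧
          ∀ c, ∃ i : Fin 3, G.cuspGp c =
            ((PuncturedSurfaceGroup.cuspInertia (g := 0) i).map ι).topologicalClosure) ∧
      CommensurableTerminalityHolds Ω ∧ OpenInterDeterminesComponentHolds Ω ∧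
      EdgeLikeIncidenceHolds Ω ∧ UnrVerticialIffHolds Ω ∧ GraphicIffEdgeLikeVerticialHolds Ω ∧
      (CuspidalEdgeLikeCharacterizationHolds Ω → NumericallyCuspidalIffHolds Ω) := by
  let Ω : PSCOrigin.{0} :=
    ⟨fun {Q} _ _ G => ∃ (_ : IsTopologicalGroup Q), CompactSpace Q ∧ T2Space Q ∧
      TotallyDisconnectedSpace Q ∧ IsEmpty G.graph.N ∧ (∀ v, G.vertGp v = ⊤) ∧
      (∃ v₀ : G.graph.V, ∀ w, w = v₀) ∧ G.Sigma = {l} ∧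
      ∃ (S : Set ℕ) (g r : ℕ) (ι : PuncturedSurfaceGroup g r →* Q) (e : G.graph.C ≃ Fin r),
        S.Nonempty ∧ (∀ p ∈ S, p.Prime) ∧ PuncturedSurfaceGroup.IsHyperbolicType g r ∧
        IsProSigmaCompletion S ι ∧
        ∀ c, G.cuspGp c = ((PuncturedSurfaceGroup.cuspInertia (g := g) (e c)).map ι).topologicalClosure⟩
  -- the pro-`l` tripod datum
  obtain ⟨Q, ι, hι⟩ :=
    IsProSigmaCompletion.exists_isProSigmaCompletion (PuncturedSurfaceGroup 0 3) ({l} : Set ℕ)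
  let T : PSCDatum Q :=
    { Sigma := {l}
      sigma_prime := fun p hp => by rw [Set.mem_singleton_iff.mp hp]; exact hl
      sigma_nonempty := ⟨l, rfl⟩
      graph := { V := Unit, N := Empty, C := Fin 3, nodeEnds := Empty.elim, cuspEnd := fun _ => () }
      vertGp := fun _ => ⊤
      nodeGp := Empty.elim
      cuspGp := fun i => ((PuncturedSurfaceGroup.cuspInertia (g := 0) i).map ι).topologicalClosure
      genus := fun _ => 0
      isClosed_vertGp := fun _ => by rw [Subgroup.coe_top]; exact isClosed_univ
      isClosed_nodeGp := fun e => e.elim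
      isClosed_cuspGp := fun _ => Subgroup.isClosed_topologicalClosure _
      nodeGp_le := fun e => e.elim
      cuspGp_le := fun _ => ⟨1, le_top⟩
      proSigma := isProSigma_of_isProSigmaCompletion hι }
  have hT : Ω.IsOfPSCType T :=
    ⟨inferInstance, inferInstance, inferInstance, inferInstance, inferInstanceAs (IsEmpty Empty),
      fun _ => rfl, ⟨(), fun _ => rfl⟩, rfl, {l}, 0, 3, ι, Equiv.refl _, ⟨l, rfl⟩,
      fun p hp => by rw [Set.mem_singleton_iff.mp hp]; exact hl,
      by unfold PuncturedSurfaceGroup.IsHyperbolicType; norm_num, hι, fun _ => rfl⟩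
  -- the smooth-curve shape hypotheses of the instance forms, read off `Ω`
  have hsc : ∀ ⦃Q : Type⦄ [Group Q] [TopologicalSpace Q] [IsTopologicalGroup Q] (G : PSCDatum Q),
      Ω.IsOfPSCType G → CompactSpace Q ∧ T2Space Q ∧ TotallyDisconnectedSpace Q ∧ IsEmpty G.graph.N ∧
        (∃ v₀ : G.graph.V, ∀ w, w = v₀) ∧
        ∃ (S : Set ℕ) (g r : ℕ) (ι : PuncturedSurfaceGroup g r →* Q) (e : G.graph.C ≃ Fin r),
          S.Nonempty ∧ (∀ p ∈ S, p.Prime) ∧ PuncturedSurfaceGroup.IsHyperbolicType g r ∧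
          IsProSigmaCompletion S ι ∧
          ∀ c, G.cuspGp c =
            ((PuncturedSurfaceGroup.cuspInertia (g := g) (e c)).map ι).topologicalClosure := by
    intro Q _ _ _ G hG
    obtain ⟨_, h1, h2, h3, h4, -, h6, -, h7⟩ := hG
    exact ⟨h1, h2, h3, h4, h6, h7⟩
  have hsc' : ∀ ⦃Q : Type⦄ [Group Q] [TopologicalSpace Q] [IsTopologicalGroup Q] (G : PSCDatum Q),
      Ω.IsOfPSCType G → CompactSpace Q ∧ T2Space Q ∧ TotallyDisconnectedSpace Q ∧ IsEmpty G.graph.N ∧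
        (∀ v, G.vertGp v = ⊤) ∧ (∃ v₀ : G.graph.V, ∀ w, w = v₀) ∧
        ∃ (S : Set ℕ) (g r : ℕ) (ι : PuncturedSurfaceGroup g r →* Q) (e : G.graph.C ≃ Fin r),
          S.Nonempty ∧ (∀ p ∈ S, p.Prime) ∧ PuncturedSurfaceGroup.IsHyperbolicType g r ∧
          IsProSigmaCompletion S ι ∧
          ∀ c, G.cuspGp c =
            ((PuncturedSurfaceGroup.cuspInertia (g := g) (e c)).map ι).topologicalClosure := by
    intro Q _ _ _ G hG
    obtain ⟨_, h1, h2, h3, h4, h5, h6, -, h7⟩ := hG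
    exact ⟨h1, h2, h3, h4, h5, h6, h7⟩
  have htop : ∀ ⦃Q : Type⦄ [Group Q] [TopologicalSpace Q] (G : PSCDatum Q), Ω.IsOfPSCType G →
      IsEmpty G.graph.N ∧ (∀ v, G.vertGp v = ⊤) ∧ Nonempty G.graph.V := by
    intro Q _ _ G hG
    obtain ⟨_, -, -, -, h4, h5, ⟨v₀, -⟩, -⟩ := hG
    exact ⟨h4, h5, ⟨v₀⟩⟩
  have hSig : ∀ ⦃Q : Type⦄ [Group Q] [TopologicalSpace Q] [IsTopologicalGroup Q] (G : PSCDatum Q),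
      Ω.IsOfPSCType G → G.Sigma = {l} := by
    intro Q _ _ _ G hG
    obtain ⟨_, -, -, -, -, -, -, h, -⟩ := hG
    exact h
  refine ⟨Ω, ⟨Q, ι, T, hι, hT, rfl, rfl, rfl, rfl, fun _ => ⟨rfl, rfl⟩, fun c => ⟨c, rfl⟩⟩,
    commensurableTerminalityHolds_of_smoothCurve Ω hsc',
    openInterDeterminesComponentHolds_of_smoothCurve Ω hsc,
    edgeLikeIncidenceHolds_of_vertGp_eq_top Ω htop,
    unrVerticialIffHolds_of_vertGp_eq_top Ω (fun _ _ _ G hG => ⟨(htop G hG).2.1, (htop G hG).2.2⟩),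
    graphicIffEdgeLikeVerticialHolds_of_smoothCurve Ω hsc' htop,
    numericallyCuspidalIffHolds_of_smoothCurve_of_characterization Ω l hsc hSig⟩

end PSCDatum

end Literature.AnabelianGeometry.SemiGraphs

end
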